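import Summits.AtomisticToContinuum.FouriersLaw.Theorems.BondHeatUncertaintyDefs
import Summits.AtomisticToContinuum.FouriersLaw.Theorems.BondHeatUncertaintySubdiffusiveBondHeatKernelGibbsA
import Literature.MathematicalPhysics.KineticTheory.ConfinedDuality
import Literature.MathematicalPhysics.KineticTheory.LangevinChainEnergyIdentity

/-!
# K1 — the path-level Lebesgue duality of the pinned chain (stub `stub_pathLebesgueDuality`)

Support file for crux `stmt-AtomisticToContinuum-9122` (`BondHeatUncertainty.LinearResponseFTUR`), line
`lebesgue-flip-duality`, stub `stub_pathLebesgueDuality` (registered signature, vocabulary of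
`Theorems/BondHeatUncertaintyDefs.lean`): for the pinned chain started from LEBESGUE measure, pure time
reversal maps the σ-finite path law `R = ∫ dz P_z` of the damped chain to `e^{2γt}` times the path law
`R̂ = ∫ dy P̂_y` of the reversed-DRIFT chain, read on the finite-dimensional observable
`(x_0, x_t, I_{i0}, I_{iN}, Q^{ib})` (endpoints, the two work integrals, the bond heat):

  `∫dz E[G(X_t, z, I_L(X), I_R(X), Q(X))] = e^{2γt} ∫dy E[G(y, X̂_t, I_L(X̂), I_R(X̂), Q(X̂))]`.

This is the PATH extension of the tree's two-time duality `dx P_t(x,dy) = e^{2γt} dy P̂_t(y,dx)`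
(`ConfinedDrift.lintegral_sdeKernel_duality`, `OscillatorChain.IsConfining.lintegral_langevinKernel_duality`),
with the same proof: for every noise sample `ω`, `x ↦ Φ_t(x, B(ω))` is a `C¹` bijection of phase space
with constant Jacobian `e^{-2γt}` (`ConfinedDrift.lintegral_comp_flow_mul`) whose inverse is the reversed
flow driven by the reversed pair `pairRev t ω`, and that reversed flow RETRACES the forward path,
`Ψ_s(Φ_t(x), pairRev t ω) = Φ_{t-s}(x)` on `[0, t]` (`ConfinedDrift.flow_reverse_eqOn`), so that along the
substitution `y = Φ_t(x)` the endpoint of the reversed path is `x` and its three `ds`-integrals of state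
functions are those of the forward path (`∫₀ᵗ f(X(t-s)) ds = ∫₀ᵗ f(X(s)) ds`); finally the reversed pair
has the law of the pair (`lintegral_comp_pairRev`) and Tonelli swaps `∫dz` and `∫dω`.

Contents (model-free part stated for a confined drift `Y` with `-Y` confined, on a finite-dimensional
space, then specialised to `pinnedChain` through `pinnedChain_isConfining` and
`pinnedChain_langevinSolMap_eq_solMap`):

* `sdeSolMap_pairRev_apply_of_mem`, `sdeSolMap_retrace`, `intervalIntegral_retrace` — the retracing;
* `measurable_intervalIntegral_sdeSolMap`, `measurable_pathObs` — measurability of the path observable;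
* `lintegral_sdePath_duality` — the model-free path duality for `H(x_0-side, x_t-side, ∫f₁, ∫f₂, ∫f₃)`;
* `stub_pathLebesgueDuality` — the registered stub.
-/

noncomputable section

namespace Summit.AtomisticToContinuum.FouriersLaw.Theorems.LinearResponseFTUR

open MeasureTheory ProbabilityTheory Filter Topology Set
open scoped NNReal ENNReal
open Literature.MathematicalPhysics.KineticTheory
open Literature.MathematicalPhysics.KineticTheory.HeatConduction
open Literature.Probability.Process
open Literature.Analysis.ODE
open Summit.AtomisticToContinuum.FouriersLaw.Theorems.BondHeatUncertainty
open Summit.AtomisticToContinuum.FouriersLaw.Theorems.SubdiffusiveBondHeat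

/-! ### Model-free part: the reversed flow driven by the reversed pair retraces the forward path -/

section Retrace

variable {E : Type*} [NormedAddCommGroup E] [NormedSpace ℝ E] [FiniteDimensional ℝ E] [CompleteSpace E]
  {Y Y' : E → E} {v₁ v₂ : E}

/-- On `[0, T]` the solution map driven by the reversed pair `pairRev T ω` is the flow driven by the
reversed noise path of `pairPath ω` (locality of the flow in the noise on `[0, T]`; the tree's
`ConfinedDrift.sdeSolMap_pairRev_eq` is the case `s = T`). -/
theorem sdeSolMap_pairRev_apply_of_mem (D' : ConfinedDrift Y') (hv₁' : v₁ ∈ D'.noise)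
    (hv₂' : v₂ ∈ D'.noise) (T : ℝ≥0) (y : E) (ω : WienerPair) {s : ℝ} (hs : s ∈ Icc (0 : ℝ) T) :
    sdeSolMap Y' v₁ v₂ s y (pairRev T ω) =
      drivenFlow Y' y (reversePath (pairNoise v₁ v₂ (pairPath ω)) T) s := by
  unfold sdeSolMap
  have hn : Continuous (pairNoise v₁ v₂ (pairPath ω)) := continuous_pairNoise v₁ v₂ _
  exact D'.flow_congr y (continuous_pairNoise v₁ v₂ _) (continuous_reversePath hn T)
    (pairNoise_mem v₁ v₂ hv₁' hv₂' _) (fun s => reversePath_mem (pairNoise_mem v₁ v₂ hv₁' hv₂' _) T s)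
    (fun s hs => pairNoise_pairRev v₁ v₂ T ω hs) hs

/-- **The reversed flow driven by the reversed pair retraces the forward path**: for `Y' = -Y` both
confined and `s ∈ [0, T]`, `Ψ_s(Φ_T(x, pairPath ω), pairRev T ω) = Φ_{T-s}(x, pairPath ω)`. -/
theorem sdeSolMap_retrace (D : ConfinedDrift Y) (D' : ConfinedDrift Y') (hv₁ : v₁ ∈ D.noise)
    (hv₂ : v₂ ∈ D.noise) (hv₁' : v₁ ∈ D'.noise) (hv₂' : v₂ ∈ D'.noise) (hY' : ∀ y, Y' y = -Y y)
    (T : ℝ≥0) (x : E) (ω : WienerPair) {s : ℝ} (hs : s ∈ Icc (0 : ℝ) T) :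
    sdeSolMap Y' v₁ v₂ s (sdeSolMap Y v₁ v₂ T x (pairPath ω)) (pairRev T ω) =
      sdeSolMap Y v₁ v₂ (T - s) x (pairPath ω) := by
  rw [sdeSolMap_pairRev_apply_of_mem D' hv₁' hv₂' T _ ω hs]
  unfold sdeSolMap
  exact D.flow_reverse_eqOn D' hY' x (continuous_pairNoise v₁ v₂ _) (pairNoise_mem v₁ v₂ hv₁ hv₂ _)
    (pairNoise_mem v₁ v₂ hv₁' hv₂' _) T.coe_nonneg hs

/-- **Time integrals of state functions are invariant under the retracing**: for every `f : E → ℝ`,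
`∫₀ᵀ f(Ψ_s(Φ_T x, pairRev T ω)) ds = ∫₀ᵀ f(Φ_{T-s} x) ds = ∫₀ᵀ f(Φ_s x) ds`. -/
theorem intervalIntegral_retrace (D : ConfinedDrift Y) (D' : ConfinedDrift Y') (hv₁ : v₁ ∈ D.noise)
    (hv₂ : v₂ ∈ D.noise) (hv₁' : v₁ ∈ D'.noise) (hv₂' : v₂ ∈ D'.noise) (hY' : ∀ y, Y' y = -Y y)
    (T : ℝ≥0) (x : E) (ω : WienerPair) (f : E → ℝ) :
    ∫ s in (0 : ℝ)..T, f (sdeSolMap Y' v₁ v₂ s (sdeSolMap Y v₁ v₂ T x (pairPath ω)) (pairRev T ω)) =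
      ∫ s in (0 : ℝ)..T, f (sdeSolMap Y v₁ v₂ s x (pairPath ω)) := by
  have h1 : ∫ s in (0 : ℝ)..T, f (sdeSolMap Y' v₁ v₂ s (sdeSolMap Y v₁ v₂ T x (pairPath ω)) (pairRev T ω)) =
      ∫ s in (0 : ℝ)..T, f (sdeSolMap Y v₁ v₂ (T - s) x (pairPath ω)) := by
    refine intervalIntegral.integral_congr fun s hs => ?_
    rw [uIcc_of_le T.coe_nonneg] at hs
    rw [sdeSolMap_retrace D D' hv₁ hv₂ hv₁' hv₂' hY' T x ω hs]
  rw [h1, intervalIntegral.integral_comp_sub_left (fun s => f (sdeSolMap Y v₁ v₂ s x (pairPath ω))) (T : ℝ),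
    sub_self, sub_zero]

end Retrace

/-! ### Model-free part: measurability of the path observable and the path duality -/

section Duality

variable {E : Type*} [NormedAddCommGroup E] [NormedSpace ℝ E] [FiniteDimensional ℝ E] [CompleteSpace E]
  [MeasurableSpace E] [BorelSpace E] [SecondCountableTopology E] {Y Y' : E → E} {v₁ v₂ : E}

/-- The time integral `∫₀ᵗ f(Φ_s(x, w)) ds` of a continuous state function along the solution map is
jointly measurable in the start `x` and the RAW pair `w` (integrand continuous in `s`, measurable in
`(x, w)`). -/
theorem measurable_intervalIntegral_sdeSolMap (D : ConfinedDrift Y) (hv₁ : v₁ ∈ D.noise)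
    (hv₂ : v₂ ∈ D.noise) {f : E → ℝ} (hf : Continuous f) (t : ℝ) :
    Measurable fun p : E × WienerPair => ∫ s in (0 : ℝ)..t, f (sdeSolMap Y v₁ v₂ s p.1 p.2) :=
  measurable_intervalIntegral_of_continuous_of_measurable
    (u := fun s (p : E × WienerPair) => f (sdeSolMap Y v₁ v₂ s p.1 p.2))
    (fun p => hf.comp (D.continuous_sdeSolMap hv₁ hv₂ p.1 p.2))
    (fun s => hf.measurable.comp (D.measurable_sdeSolMap hv₁ hv₂ s)) t

/-- The path observable `(x, Φ_t(x, w), ∫₀ᵗ f₁(Φ_s(x, w)) ds, ∫₀ᵗ f₂(…) ds, ∫₀ᵗ f₃(…) ds)` is jointly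
measurable in `(x, w)` for continuous state functions `f₁, f₂, f₃`. -/
theorem measurable_pathObs (D : ConfinedDrift Y) (hv₁ : v₁ ∈ D.noise) (hv₂ : v₂ ∈ D.noise)
    {f₁ f₂ f₃ : E → ℝ} (hf₁ : Continuous f₁) (hf₂ : Continuous f₂) (hf₃ : Continuous f₃) (t : ℝ) :
    Measurable fun p : E × WienerPair =>
      (p.1, sdeSolMap Y v₁ v₂ t p.1 p.2, ∫ s in (0 : ℝ)..t, f₁ (sdeSolMap Y v₁ v₂ s p.1 p.2),
        ∫ s in (0 : ℝ)..t, f₂ (sdeSolMap Y v₁ v₂ s p.1 p.2),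
        ∫ s in (0 : ℝ)..t, f₃ (sdeSolMap Y v₁ v₂ s p.1 p.2)) :=
  measurable_fst.prodMk ((D.measurable_sdeSolMap hv₁ hv₂ t).prodMk
    ((measurable_intervalIntegral_sdeSolMap D hv₁ hv₂ hf₁ t).prodMk
      ((measurable_intervalIntegral_sdeSolMap D hv₁ hv₂ hf₂ t).prodMk
        (measurable_intervalIntegral_sdeSolMap D hv₁ hv₂ hf₃ t))))

/-- **Path-level duality of an additive-noise SDE with a confined drift of constant divergence with
respect to Haar measure.** For `Y' = -Y` both confined, `tr DY ≡ d`, `t > 0`, continuous state functions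
`f₁, f₂, f₃` and measurable `H ≥ 0` on `E × E × ℝ × ℝ × ℝ`:
`∫ μ(dx) E[H(Φ_t x, x, ∫₀ᵗ fₖ(Φ_s x) ds)] = e^{-dt} ∫ μ(dy) E[H(y, Ψ_t y, ∫₀ᵗ fₖ(Ψ_s y) ds)]`, where
`Φ` is the flow of `dz = Y dt + v₁dB¹ + v₂dB²` and `Ψ` that of `dz = Y' dt + v₁dB¹ + v₂dB²` (pathwise
change of variables `y = Φ_t(x, B(ω))` with Jacobian `e^{dt}`, retracing, invariance of the pair under
time reversal, Tonelli). The two-time case is `ConfinedDrift.lintegral_sdeKernel_duality`. -/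
theorem lintegral_sdePath_duality (D : ConfinedDrift Y) (D' : ConfinedDrift Y') (hv₁ : v₁ ∈ D.noise)
    (hv₂ : v₂ ∈ D.noise) (hv₁' : v₁ ∈ D'.noise) (hv₂' : v₂ ∈ D'.noise) (μ : Measure E)
    [μ.IsAddHaarMeasure] (hY' : ∀ y, Y' y = -Y y) {d : ℝ}
    (hdiv : ∀ y, LinearMap.trace ℝ E (fderiv ℝ Y y : E →ₗ[ℝ] E) = d) {t : ℝ} (ht : 0 < t)
    {f₁ f₂ f₃ : E → ℝ} (hf₁ : Continuous f₁) (hf₂ : Continuous f₂) (hf₃ : Continuous f₃)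
    {H : E × E × ℝ × ℝ × ℝ → ℝ≥0∞} (hH : Measurable H) :
    ∫⁻ x, ∫⁻ ω, H (sdeSolMap Y v₁ v₂ t x (pairPath ω), x,
        ∫ s in (0 : ℝ)..t, f₁ (sdeSolMap Y v₁ v₂ s x (pairPath ω)),
        ∫ s in (0 : ℝ)..t, f₂ (sdeSolMap Y v₁ v₂ s x (pairPath ω)),
        ∫ s in (0 : ℝ)..t, f₃ (sdeSolMap Y v₁ v₂ s x (pairPath ω))) ∂wienerPair ∂μ =
      ENNReal.ofReal (Real.exp (-(d * t))) *
        ∫⁻ y, ∫⁻ ω, H (y, sdeSolMap Y' v₁ v₂ t y (pairPath ω),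
          ∫ s in (0 : ℝ)..t, f₁ (sdeSolMap Y' v₁ v₂ s y (pairPath ω)),
          ∫ s in (0 : ℝ)..t, f₂ (sdeSolMap Y' v₁ v₂ s y (pairPath ω)),
          ∫ s in (0 : ℝ)..t, f₃ (sdeSolMap Y' v₁ v₂ s y (pairPath ω))) ∂wienerPair ∂μ := by
  set T : ℝ≥0 := ⟨t, ht.le⟩ with hT
  -- the observable of the reversed path from `y` driven by a RAW pair `w`
  set R : E × WienerPair → E × E × ℝ × ℝ × ℝ := fun p =>
    (p.1, sdeSolMap Y' v₁ v₂ t p.1 p.2, ∫ s in (0 : ℝ)..t, f₁ (sdeSolMap Y' v₁ v₂ s p.1 p.2),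
      ∫ s in (0 : ℝ)..t, f₂ (sdeSolMap Y' v₁ v₂ s p.1 p.2),
      ∫ s in (0 : ℝ)..t, f₃ (sdeSolMap Y' v₁ v₂ s p.1 p.2)) with hR
  have hRm : Measurable R := measurable_pathObs D' hv₁' hv₂' hf₁ hf₂ hf₃ t
  -- the (swapped) observable of the forward path from `x` driven by `pairPath ω`
  set L : E × WienerPair → E × E × ℝ × ℝ × ℝ := fun p =>
    (sdeSolMap Y v₁ v₂ t p.1 (pairPath p.2), p.1,
      ∫ s in (0 : ℝ)..t, f₁ (sdeSolMap Y v₁ v₂ s p.1 (pairPath p.2)),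
      ∫ s in (0 : ℝ)..t, f₂ (sdeSolMap Y v₁ v₂ s p.1 (pairPath p.2)),
      ∫ s in (0 : ℝ)..t, f₃ (sdeSolMap Y v₁ v₂ s p.1 (pairPath p.2))) with hL
  have hLm : Measurable L := by
    have h0 : Measurable fun p : E × WienerPair => (p.1, pairPath p.2) :=
      measurable_fst.prodMk (measurable_pairPath.comp measurable_snd)
    have h := (measurable_pathObs D hv₁ hv₂ hf₁ hf₂ hf₃ t).comp h0
    exact (measurable_fst.comp (measurable_snd.comp h)).prodMk
      ((measurable_fst.comp h).prodMk (measurable_snd.comp (measurable_snd.comp h)))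
  change ∫⁻ x, ∫⁻ ω, H (L (x, ω)) ∂wienerPair ∂μ =
    ENNReal.ofReal (Real.exp (-(d * t))) * ∫⁻ y, ∫⁻ ω, H (R (y, pairPath ω)) ∂wienerPair ∂μ
  have hm1 : Measurable fun p : E × WienerPair => H (L p) := hH.comp hLm
  have hm2 : Measurable fun p : WienerPair × E => H (R (p.2, pairRev T p.1)) :=
    hH.comp (hRm.comp (measurable_snd.prodMk ((measurable_pairRev T).comp measurable_fst)))
  -- swap, change variables pathwise, swap back
  rw [lintegral_lintegral_swap hm1.aemeasurable]
  have hpath : ∀ ω, ∫⁻ x, H (L (x, ω)) ∂μ =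
      ENNReal.ofReal (Real.exp (-(d * t))) * ∫⁻ y, H (R (y, pairRev T ω)) ∂μ := by
    intro ω
    have hn : Continuous (pairNoise v₁ v₂ (pairPath ω)) := continuous_pairNoise v₁ v₂ _
    have hnS : ∀ s, pairNoise v₁ v₂ (pairPath ω) s ∈ D.noise := pairNoise_mem v₁ v₂ hv₁ hv₂ _
    have hnS' : ∀ s, pairNoise v₁ v₂ (pairPath ω) s ∈ D'.noise := pairNoise_mem v₁ v₂ hv₁' hv₂' _
    have hn0 : pairNoise v₁ v₂ (pairPath ω) 0 = 0 := pairNoise_zero v₁ v₂ _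
    -- the retracing: `H (L (x, ω)) = g (Φ_t x)` with `g y = H (R (y, pairRev T ω))`
    have hLg : ∀ x, H (L (x, ω)) = H (R (sdeSolMap Y v₁ v₂ t x (pairPath ω), pairRev T ω)) := by
      intro x
      simp only [hL, hR]
      congr 1
      refine Prod.ext rfl (Prod.ext ?_ (Prod.ext ?_ (Prod.ext ?_ ?_)))
      · exact (D.sdeSolMap_reverse D' hv₁ hv₂ hv₁' hv₂' hY' T x ω).symm
      · exact (intervalIntegral_retrace D D' hv₁ hv₂ hv₁' hv₂' hY' T x ω f₁).symm
      · exact (intervalIntegral_retrace D D' hv₁ hv₂ hv₁' hv₂' hY' T x ω f₂).symm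
      · exact (intervalIntegral_retrace D D' hv₁ hv₂ hv₁' hv₂' hY' T x ω f₃).symm
    have hcv := D.lintegral_comp_flow_mul μ D' hY' hn hnS hnS' hn0 ht hdiv
      (fun y => H (R (y, pairRev T ω)))
    have hone : ENNReal.ofReal (Real.exp (-(d * t))) * ENNReal.ofReal (Real.exp (d * t)) = 1 := by
      rw [← ENNReal.ofReal_mul (Real.exp_pos _).le, ← Real.exp_add, neg_add_cancel, Real.exp_zero,
        ENNReal.ofReal_one]
    calc ∫⁻ x, H (L (x, ω)) ∂μ
        = ∫⁻ x, ENNReal.ofReal (Real.exp (-(d * t))) * (ENNReal.ofReal (Real.exp (d * t)) *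
            H (R (drivenFlow Y x (pairNoise v₁ v₂ (pairPath ω)) t, pairRev T ω))) ∂μ := by
          refine lintegral_congr fun x => ?_
          rw [← mul_assoc, hone, one_mul, hLg x]
          rfl
      _ = ENNReal.ofReal (Real.exp (-(d * t))) * ∫⁻ y, H (R (y, pairRev T ω)) ∂μ := by
          rw [lintegral_const_mul' _ _ ENNReal.ofReal_ne_top, hcv]
  simp_rw [hpath]
  rw [lintegral_const_mul' _ _ ENNReal.ofReal_ne_top, lintegral_lintegral_swap hm2.aemeasurable]
  congr 1
  refine lintegral_congr fun y => ?_
  exact lintegral_comp_pairRev (hH.comp (hRm.comp (measurable_const.prodMk measurable_id))) T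

end Duality

/-! ### The registered stub -/

/-- **K1 — path-level Lebesgue duality of the pinned chain** (stub `stub_pathLebesgueDuality` of line
`lebesgue-flip-duality`, crux `LinearResponseFTUR`). For `ω₂, lam, β, γ > 0`, `N ≥ 2`, bath sites
`i0 = 0`, `iN = N - 1`, any bond `ib`, `T_L, T_R > 0`, `t > 0` and measurable `G ≥ 0` on `Obs N`:
`∫dz E[G(swapObs(rawObs z (fwdPath z)))] = e^{2γt} ∫dy E[G(rawObs y (revPath y))]`, i.e. under pure
time reversal (endpoints swapped, the work integrals `I_{i0}, I_{iN}` and the bond heat `Q^{ib}` kept)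
the damped chain from Lebesgue measure becomes `e^{2γt}` times the reversed-drift chain from Lebesgue
measure. Proof: `lintegral_sdePath_duality` for the confined drift of the pinned chain
(`pinnedChain_isConfining`, reversal `IsConfining.reversedDrift`, divergence `-2γ` by
`OscillatorChain.trace_fderiv_drift`), the forward path being put on the model-free pipeline by
`pinnedChain_langevinSolMap_eq_solMap`. -/
theorem stub_pathLebesgueDuality :
  ∀ ω₂ lam β γ : ℝ, 0 < ω₂ → 0 < lam → 0 < β → 0 < γ →
  ∀ (N : ℕ) (i0 iN ib : Fin N), 2 ≤ N → i0.val = 0 → iN.val = N - 1 →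
  ∀ (T_L T_R : ℝ), 0 < T_L → 0 < T_R → ∀ t : ℝ, 0 < t →
  ∀ G : Obs N → ℝ≥0∞, Measurable G →
    ∫⁻ z, ∫⁻ w, G (swapObs N (rawObs (pinnedChain ω₂ lam β γ) N i0 iN ib t z
        (fwdPath (pinnedChain ω₂ lam β γ) N T_L T_R z w))) ∂wienerPair =
      ENNReal.ofReal (Real.exp (2 * γ * t)) *
        ∫⁻ y, ∫⁻ w, G (rawObs (pinnedChain ω₂ lam β γ) N i0 iN ib t y
          (revPath (pinnedChain ω₂ lam β γ) N T_L T_R y w)) ∂wienerPair := by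
  intro ω₂ lam β γ hω hl hβ hγ N i0 iN ib hN _hi0 _hiN T_L T_R _hTL _hTR t ht G hG
  have hP : (pinnedChain ω₂ lam β γ).IsConfining := pinnedChain_isConfining hω hl.le hβ.le hγ.le
  have hN0 : 0 < N := by omega
  haveI := isAddHaarMeasure_volume_phaseSpace N
  have hH1 : ContDiff ℝ 1 ((pinnedChain ω₂ lam β γ).hamiltonian N) :=
    (pinnedChain ω₂ lam β γ).contDiff_hamiltonian (pinnedChain_contDiff_U ω₂ lam β γ)
      (pinnedChain_contDiff_V ω₂ lam β γ) N
  have hf : ∀ i : Fin N, Continuous fun y : PhaseSpace N =>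
      y.2 i * partialQ i ((pinnedChain ω₂ lam β γ).hamiltonian N) y := fun i =>
    ((continuous_apply i).comp continuous_snd).mul
      ((pinnedChain ω₂ lam β γ).continuous_partialQ_hamiltonian hH1 i)
  have hj : Continuous ((pinnedChain ω₂ lam β γ).bondCurrent N ib) :=
    pinnedChain_continuous_bondCurrent ω₂ lam β γ N ib
  have hdiv := (pinnedChain ω₂ lam β γ).trace_fderiv_drift (pinnedChain_contDiff_U ω₂ lam β γ)
    (pinnedChain_contDiff_V ω₂ lam β γ) hN0
  have h := lintegral_sdePath_duality (hP.confinedDrift N).toConfinedDrift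
    (hP.reversedDrift N).toConfinedDrift (hP.bathVecL_mem_noise N T_L) (hP.bathVecR_mem_noise N T_R)
    (hP.bathVecL_mem_reversedDrift_noise N T_L) (hP.bathVecR_mem_reversedDrift_noise N T_R)
    volume (fun _ => rfl) hdiv ht (hf i0) (hf iN) hj hG
  have he : -(-(2 * (pinnedChain ω₂ lam β γ).γ) * t) = 2 * γ * t := by
    show -(-(2 * γ) * t) = 2 * γ * t
    ring
  rw [he] at h
  have hsol : (pinnedChain ω₂ lam β γ).solMap N T_L T_R =
      sdeSolMap ((pinnedChain ω₂ lam β γ).drift N) ((pinnedChain ω₂ lam β γ).bathVecL N T_L)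
        ((pinnedChain ω₂ lam β γ).bathVecR N T_R) :=
    (pinnedChain_langevinSolMap_eq_solMap ω₂ lam β γ N T_L T_R).symm
  simp only [swapObs, rawObs, workIntegral, bondHeat, fwdPath_apply, revPath_apply, hsol]
  exact h

end Summit.AtomisticToContinuum.FouriersLaw.Theorems.LinearResponseFTUR

end
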